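import Summits.BirchSwinnertonDyer.Rank1Residual.X1.GeneratorCountAnomalousLeaf
import Summits.BirchSwinnertonDyer.Rank1Residual.X1.AnomalousStrictAtP
import Literature.NumberTheory.EllipticCurves.AnomalousOfRationalTorsionProofs
import HarnessLib

/-!
# Route M's generator COUNT, V: the leaf consumers with counts `#S + 1` / `#S + 2` and the local
# hypothesis `hloc` DISCHARGED (V79) — Greenberg's Prop. 2.4 by name instead
# (cell `b2b-bsdres`, unit `b2b-bsdres-eisenstein-p1`, gen 16; FILE 6, imports FILE 4 and V79)

HONEST FRAMING (run/shared/lean/b2b/bsd-rank1-residual/, verbatim in every file): the goal of the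
cell is to DELETE the COMBINATION-SHAPED residual classes of the Birch–Swinnerton-Dyer formula for
ALL analytic-rank `≤ 1` elliptic curves over `ℚ` — "full BSD formula for every rank `≤ 1` curve in
class `C`" assembled STRICTLY from published theorems — so that the rank-`≤ 1` remainder becomes
exactly the CONSTRUCTION-SHAPED classes, which are TYPED (missing-input `Prop`s), NOT attempted.
This is not "finishing BSD". Sub-cell `b2b-bsdres-eisenstein-p1`: research route; NO CLAIM BEYOND
STATED CLASSES; nothing here changes a label; nothing is booked (the per-pair rows these theorems
serve are EVIDENCE of this unit's table, referee to countersign). THEOREMS ONLY (no `def`, no named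
fact introduced): the named facts are the PUBLISHED ones of FILE 4 (Wuthrich 2014 Thm. 16; Greenberg
1999 Thm. 4.1 / Prop. 3.10 / Prop. 4.15 (ii); modularity; Gross–Zagier–Kolyvagin; Poitou–Tate duality
over `ℚ`) plus Greenberg 1999 Prop. 2.4 (`Greenberg1999.imKummer_ge_strictCondition_goodOrdinary`,
`hGrK`) which REPLACES the ad-hoc ∀-hypothesis `hloc` of FILES 3–5: on the leaf X1 ∩ {r = 0} every
prime is odd, good, ordinary and ANOMALOUS, and there `hloc` is the theorem
`AnomalousStrictAtP.hloc_of_anomalous` (V79: `Ẽ[p] ⊆ Ẽ(𝔽_p)` + local Kronecker–Weber).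

What. `Leaf.hloc_of_prop24` — `hloc` on the leaf from `hGrK`; then the six consumers of FILE 4
(`GeneratorCountAnomalousLeaf`) with `hloc` discharged, suffix `_of_prop24`: counts `#S + 1`
(`μ = 0`, `μ = 0` ∩ second certificate, `μ ≥ 1` member) and `#S + 2` (same three, with a `ℚ_p`-point
of order `p`). Census stakes (X1R0-GAPMAP §24.2): 69 resp. 177 of the 482 route-M₀ closures of record
bind at a `δ = 0` member with `B = t₀ + 1` resp. `t₀ + a`; their kernel tier is now "LEMMA M₀ + COUNT
(PT + Prop. 2.4 named) + typed Newton certificate" with NO ad-hoc hypothesis.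

References: [GreenbergLNM1716] §2 Prop. 2.4 (pp. 74–75), §3 Lemma 3.4 (p. 89), Prop. 3.10, Thm. 4.1,
§5; [Wuthrich2014] Thm. 16; X1R0-GAPMAP §24.2, §24.5, §25.
-/

noncomputable section

open scoped Classical

open Function Field NumberField IsDedekindDomain WeierstrassCurve
  Literature.NumberTheory.EllipticCurves Literature.NumberTheory.GaloisRepresentations
  Literature.NumberTheory.GaloisCohomology Summit.BirchSwinnertonDyer.Rank1Residual.GaloisImage
  Summit.BirchSwinnertonDyer.Rank1Residual.X1.GeneratorCountAnomalous
  Summit.BirchSwinnertonDyer.Rank1Residual.X1.GeneratorCountAnomalousTwo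
  Summit.BirchSwinnertonDyer.Rank1Residual.X1.GeneratorCountAnomalousLeaf

set_option autoImplicit false

namespace Summit.BirchSwinnertonDyer.Rank1Residual.X1.GeneratorCountAnomalousLeaf

variable {W : WeierstrassCurve ℚ} [W.IsElliptic] {p : ℕ} [hp : Fact p.Prime]

section Leaf

open Literature.NumberTheory.EllipticCurves.Rank1Residual
  Literature.NumberTheory.EllipticCurves.ModularForms
  Literature.NumberTheory.EllipticCurves.Greenberg1999
  Summit.BirchSwinnertonDyer.BirchSwinnertonDyer.Theorems.Rank1ResidualX1Defs
  Summit.BirchSwinnertonDyer.Rank1Residual.X1.MuLambda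
  Summit.BirchSwinnertonDyer.Rank1Residual.X1.MuPart
  Summit.BirchSwinnertonDyer.Rank1Residual.X1.ParitySqueeze
  Summit.BirchSwinnertonDyer.Rank1Residual.X1.TamagawaSqueeze
  Summit.BirchSwinnertonDyer.Rank1Residual.X1.FactorSqueeze
  Summit.BirchSwinnertonDyer.Rank1Residual.X1.GeneratorSqueeze
  Summit.BirchSwinnertonDyer.Rank1Residual.X1.GeneratorCountSqueeze
  Summit.BirchSwinnertonDyer.Rank1Residual.X1.GeneratorCountSqueezeFacts

variable [W.IsGloballyMinimal]

/-! ## §5. `hloc` on the leaf -/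

/-- **`hloc` HOLDS ON THE LEAF X1 ∩ {r = 0}** (Greenberg's Prop. 2.4 `hGrK` by name): a leaf prime is
odd (`two_ne`), good (`p ∤ Δ_E`), ordinary (`p ∤ a_p`) and anomalous (`p ∣ a_p − 1 ⇔ p ∣ #Ẽ(𝔽_p)`), so
V79 (`AnomalousStrictAtP.hloc_of_anomalous`) applies. [cite: GreenbergLNM1716, §2 Prop. 2.4 (pp. 74–75) and §3 Lemma 3.4 (p. 89)] -/
theorem Leaf.hloc_of_prop24 (hGrK : imKummer_ge_strictCondition_goodOrdinary)
    (hL : RankZero.Leaf W p) :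
    ∀ (κ : ZpExtension ℚ p), κ.IsCyclotomic → ∀ (v : HeightOneSpectrum (𝓞 ℚ)),
      ((p : ℕ) : 𝓞 ℚ) ∈ v.asIdeal → ∀ y : galH1Torsion W (p : ℤ),
      W.layerToInfty κ 0 (resH1Hom (Literature.NumberTheory.EllipticCurves.subgroupIncl (κ.layerSubgroup 0))
          (AddMonoidHom.id (geomPrimaryTorsion W p)) (fun _ _ ↦ rfl) (torsionToPrimaryH1 W p y)) ∈
        W.localKerOver p κ.kerSubgroup (v.adicCompletion ℚ) :=
  have hX := isClassX1_of_classX1 hL.classX1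
  AnomalousStrictAtP.hloc_of_anomalous p W hGrK hX.two_ne
    (W.not_dvd_minimalDiscriminantInt_of_hasGoodReductionAtPrime' p hX.hasGoodReductionAtPrime)
    hX.not_dvd_frobeniusTrace
    ((dvd_reductionPointCount_iff_dvd_frobeniusTrace_sub_one W p).mpr hX.dvd_frobeniusTrace_sub_one)

/-! ## §6. The six leaf consumers with `hloc` discharged -/

/-- **ROUTE M at the `μ = 0` member, count `#S + 1`, `p ∤ #E(ℚ)_tors`, `hloc` DISCHARGED:**
`μ_an = 0 ∧ λ_an = n ∧ (p ∣ c_v on S) ∧ (Newton data S') ∧ gap ⇒ BSD(E,p)` on the leaf, Greenberg's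
Prop. 2.4 (`hGrK`) BY NAME in place of the ad-hoc local hypothesis (V79 `Leaf.hloc`).
[cite: GreenbergLNM1716, §2 Prop. 2.4, §3 Lemma 3.4, Prop. 3.10, Thm. 4.1, §5 pp. 114–118, p. 137]
[cite: Wuthrich2014, Thm. 16 (p. 397)] -/
theorem Leaf.bsdp_of_muZero_of_tamagawaCountAtP_of_prop24
    (hW16 : Wuthrich2014.charIdeal_dvd_padicLFunction) (hGr : greenberg_charValue_rankZero)
    (h310 : prop310_selmerCorank_mod_two_eq_lambdaInvariant)
    (h415 : prop415ii_noFiniteSubmodule_of_ordinary_or_multiplicative)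
    (hmod : nonempty_modularParametrizationData)
    (hGZK : rank_eq_analyticRank_of_analyticRank_le_one)
    (hPT : poitouTate_selmerStructure_duality ℚ)
    (hL : RankZero.Leaf W p) (htors : ¬ p ∣ W.torsionOrder) (hGrK : imKummer_ge_strictCondition_goodOrdinary)
    (hμ0 : AnalyticMuLE W p 0) {n : ℕ} {S' : Set (ℕ × ℕ)} (hlam : AnalyticLambdaEq W p n)
    (S : Finset (HeightOneSpectrum (𝓞 ℚ))) (hSp : ∀ v ∈ S, ((p : ℕ) : 𝓞 ℚ) ∉ v.asIdeal)
    (hcv : ∀ v ∈ S,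
      p ∣ (W.baseChange (v.adicCompletion ℚ)).localTamagawaNumber (v.adicCompletionIntegers ℚ))
    (vp : HeightOneSpectrum (𝓞 ℚ)) (hvp : ((p : ℕ) : 𝓞 ℚ) ∈ vp.asIdeal)
    (hS : AnalyticLamConstValDivisorSet W p S')
    (hgap : ∀ d v, (d, v) ∈ S' → S.card + 1 ≤ v → Even d → d ≤ n → n ≤ d + 1) : BSDp W p :=
  Leaf.bsdp_of_muZero_of_tamagawaCountAtP hW16 hGr h310 h415 hmod hGZK hPT hL htors
    (Leaf.hloc_of_prop24 hGrK hL) hμ0 hlam S hSp hcv vp hvp hS hgap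

/-- **The same intersected with a second membership certificate** (M₀ ∘ C shape), count `#S + 1`,
`hloc` DISCHARGED. [cite: GreenbergLNM1716, §2 Prop. 2.4, Prop. 3.10, Thm. 4.1, §5 pp. 114–118, pp. 132, 137]
[cite: Wuthrich2014, Thm. 16 (p. 397)] -/
theorem Leaf.bsdp_of_muZero_of_tamagawaCountAtP_inter_of_prop24
    (hW16 : Wuthrich2014.charIdeal_dvd_padicLFunction) (hGr : greenberg_charValue_rankZero)
    (h310 : prop310_selmerCorank_mod_two_eq_lambdaInvariant)
    (h415 : prop415ii_noFiniteSubmodule_of_ordinary_or_multiplicative)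
    (hmod : nonempty_modularParametrizationData)
    (hGZK : rank_eq_analyticRank_of_analyticRank_le_one)
    (hPT : poitouTate_selmerStructure_duality ℚ)
    (hL : RankZero.Leaf W p) (htors : ¬ p ∣ W.torsionOrder) (hGrK : imKummer_ge_strictCondition_goodOrdinary)
    (hμ0 : AnalyticMuLE W p 0) {n : ℕ} {S' : Set (ℕ × ℕ)} {A' : Set ℕ}
    (hlam : AnalyticLambdaEq W p n) (S : Finset (HeightOneSpectrum (𝓞 ℚ)))
    (hSp : ∀ v ∈ S, ((p : ℕ) : 𝓞 ℚ) ∉ v.asIdeal)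
    (hcv : ∀ v ∈ S,
      p ∣ (W.baseChange (v.adicCompletion ℚ)).localTamagawaNumber (v.adicCompletionIntegers ℚ))
    (vp : HeightOneSpectrum (𝓞 ℚ)) (hvp : ((p : ℕ) : 𝓞 ℚ) ∈ vp.asIdeal)
    (hS : AnalyticLamConstValDivisorSet W p S') (hA' : AlgebraicLambdaMem W p A')
    (hgap : ∀ d v, (d, v) ∈ S' → S.card + 1 ≤ v → d ∈ A' → Even d → d ≤ n → n ≤ d + 1) :
    BSDp W p :=
  Leaf.bsdp_of_muZero_of_tamagawaCountAtP_inter hW16 hGr h310 h415 hmod hGZK hPT hL htors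
    (Leaf.hloc_of_prop24 hGrK hL) hμ0 hlam S hSp hcv vp hvp hS hA' hgap

/-- **ROUTE M at a `μ ≥ 1` member with `p ∤ #E(ℚ)_tors`, count `#S + 1`, `hloc` DISCHARGED**
(μ-part `MuPartAt W p`). [cite: GreenbergLNM1716, §2 Prop. 2.4, Prop. 3.10, Thm. 4.1, §5 pp. 114–118, p. 137]
[cite: Wuthrich2014, Thm. 16 (p. 397)] -/
theorem Leaf.bsdp_of_muPartAt_of_tamagawaCountAtP_of_prop24
    (hW16 : Wuthrich2014.charIdeal_dvd_padicLFunction) (hGr : greenberg_charValue_rankZero)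
    (h310 : prop310_selmerCorank_mod_two_eq_lambdaInvariant)
    (h415 : prop415ii_noFiniteSubmodule_of_ordinary_or_multiplicative)
    (hmod : nonempty_modularParametrizationData)
    (hGZK : rank_eq_analyticRank_of_analyticRank_le_one)
    (hPT : poitouTate_selmerStructure_duality ℚ)
    (hL : RankZero.Leaf W p) (htors : ¬ p ∣ W.torsionOrder) (hGrK : imKummer_ge_strictCondition_goodOrdinary)
    (hμ : MuPartAt W p) {n : ℕ} {S' : Set (ℕ × ℕ)} (hlam : AnalyticLambdaEq W p n)
    (S : Finset (HeightOneSpectrum (𝓞 ℚ))) (hSp : ∀ v ∈ S, ((p : ℕ) : 𝓞 ℚ) ∉ v.asIdeal)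
    (hcv : ∀ v ∈ S,
      p ∣ (W.baseChange (v.adicCompletion ℚ)).localTamagawaNumber (v.adicCompletionIntegers ℚ))
    (vp : HeightOneSpectrum (𝓞 ℚ)) (hvp : ((p : ℕ) : 𝓞 ℚ) ∈ vp.asIdeal)
    (hS : AnalyticLamConstValDivisorSet W p S')
    (hgap : ∀ d v, (d, v) ∈ S' → S.card + 1 ≤ v → Even d → d ≤ n → n ≤ d + 1) : BSDp W p :=
  Leaf.bsdp_of_muPartAt_of_tamagawaCountAtP hW16 hGr h310 h415 hmod hGZK hPT hL htors
    (Leaf.hloc_of_prop24 hGrK hL) hμ hlam S hSp hcv vp hvp hS hgap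

/-- **ROUTE M at the `μ = 0` member, count `#S + 2`, `hloc` DISCHARGED** (a `ℚ_p`-point of order
`p` on `E`): `μ_an = 0 ∧ λ_an = n ∧ (p ∣ c_v on S) ∧ E(ℚ_p)[p] ≠ 0 ∧ (Newton data S') ∧ gap ⇒ BSD(E,p)`.
[cite: GreenbergLNM1716, §2 Prop. 2.4, §3 Lemma 3.4, Prop. 3.10, Thm. 4.1, §5 pp. 114–118, p. 137]
[cite: Wuthrich2014, Thm. 16 (p. 397)] -/
theorem Leaf.bsdp_of_muZero_of_tamagawaCountAtP_two_of_prop24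
    (hW16 : Wuthrich2014.charIdeal_dvd_padicLFunction) (hGr : greenberg_charValue_rankZero)
    (h310 : prop310_selmerCorank_mod_two_eq_lambdaInvariant)
    (h415 : prop415ii_noFiniteSubmodule_of_ordinary_or_multiplicative)
    (hmod : nonempty_modularParametrizationData)
    (hGZK : rank_eq_analyticRank_of_analyticRank_le_one)
    (hPT : poitouTate_selmerStructure_duality ℚ)
    (hL : RankZero.Leaf W p) (htors : ¬ p ∣ W.torsionOrder)
    (hGrK : imKummer_ge_strictCondition_goodOrdinary)
    (hμ0 : AnalyticMuLE W p 0) {n : ℕ} {S' : Set (ℕ × ℕ)} (hlam : AnalyticLambdaEq W p n)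
    (S : Finset (HeightOneSpectrum (𝓞 ℚ))) (hSp : ∀ v ∈ S, ((p : ℕ) : 𝓞 ℚ) ∉ v.asIdeal)
    (hcv : ∀ v ∈ S,
      p ∣ (W.baseChange (v.adicCompletion ℚ)).localTamagawaNumber (v.adicCompletionIntegers ℚ))
    (vp : HeightOneSpectrum (𝓞 ℚ)) (hvp : ((p : ℕ) : 𝓞 ℚ) ∈ vp.asIdeal)
    (hPt : ∃ P : (W.baseChange (vp.adicCompletion ℚ)).toAffine.Point, P ≠ 0 ∧ p • P = 0)
    (hS : AnalyticLamConstValDivisorSet W p S')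
    (hgap : ∀ d v, (d, v) ∈ S' → S.card + 2 ≤ v → Even d → d ≤ n → n ≤ d + 1) : BSDp W p :=
  Leaf.bsdp_of_muZero_of_tamagawaCountAtP_two hW16 hGr h310 h415 hmod hGZK hPT hL htors
    (Leaf.hloc_of_prop24 hGrK hL) hμ0 hlam S hSp hcv vp hvp hPt hS hgap

/-- **The same intersected with a second membership certificate** (M₀ ∘ C shape), count `#S + 2`,
`hloc` DISCHARGED. [cite: GreenbergLNM1716, §2 Prop. 2.4, Prop. 3.10, Thm. 4.1, §5 pp. 114–118, pp. 132, 137]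
[cite: Wuthrich2014, Thm. 16 (p. 397)] -/
theorem Leaf.bsdp_of_muZero_of_tamagawaCountAtP_two_inter_of_prop24
    (hW16 : Wuthrich2014.charIdeal_dvd_padicLFunction) (hGr : greenberg_charValue_rankZero)
    (h310 : prop310_selmerCorank_mod_two_eq_lambdaInvariant)
    (h415 : prop415ii_noFiniteSubmodule_of_ordinary_or_multiplicative)
    (hmod : nonempty_modularParametrizationData)
    (hGZK : rank_eq_analyticRank_of_analyticRank_le_one)
    (hPT : poitouTate_selmerStructure_duality ℚ)
    (hL : RankZero.Leaf W p) (htors : ¬ p ∣ W.torsionOrder)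
    (hGrK : imKummer_ge_strictCondition_goodOrdinary)
    (hμ0 : AnalyticMuLE W p 0) {n : ℕ} {S' : Set (ℕ × ℕ)} {A' : Set ℕ}
    (hlam : AnalyticLambdaEq W p n) (S : Finset (HeightOneSpectrum (𝓞 ℚ)))
    (hSp : ∀ v ∈ S, ((p : ℕ) : 𝓞 ℚ) ∉ v.asIdeal)
    (hcv : ∀ v ∈ S,
      p ∣ (W.baseChange (v.adicCompletion ℚ)).localTamagawaNumber (v.adicCompletionIntegers ℚ))
    (vp : HeightOneSpectrum (𝓞 ℚ)) (hvp : ((p : ℕ) : 𝓞 ℚ) ∈ vp.asIdeal)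
    (hPt : ∃ P : (W.baseChange (vp.adicCompletion ℚ)).toAffine.Point, P ≠ 0 ∧ p • P = 0)
    (hS : AnalyticLamConstValDivisorSet W p S') (hA' : AlgebraicLambdaMem W p A')
    (hgap : ∀ d v, (d, v) ∈ S' → S.card + 2 ≤ v → d ∈ A' → Even d → d ≤ n → n ≤ d + 1) :
    BSDp W p :=
  Leaf.bsdp_of_muZero_of_tamagawaCountAtP_two_inter hW16 hGr h310 h415 hmod hGZK hPT hL htors
    (Leaf.hloc_of_prop24 hGrK hL) hμ0 hlam S hSp hcv vp hvp hPt hS hA' hgap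

/-- **ROUTE M at a `μ ≥ 1` member with `p ∤ #E(ℚ)_tors` and a `ℚ_p`-point of order `p`, count
`#S + 2`, `hloc` DISCHARGED** (μ-part `MuPartAt W p`).
[cite: GreenbergLNM1716, §2 Prop. 2.4, §3 Lemma 3.4, Prop. 3.10, Thm. 4.1, §5 pp. 114–118, p. 137]
[cite: Wuthrich2014, Thm. 16 (p. 397)] -/
theorem Leaf.bsdp_of_muPartAt_of_tamagawaCountAtP_two_of_prop24
    (hW16 : Wuthrich2014.charIdeal_dvd_padicLFunction) (hGr : greenberg_charValue_rankZero)
    (h310 : prop310_selmerCorank_mod_two_eq_lambdaInvariant)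
    (h415 : prop415ii_noFiniteSubmodule_of_ordinary_or_multiplicative)
    (hmod : nonempty_modularParametrizationData)
    (hGZK : rank_eq_analyticRank_of_analyticRank_le_one)
    (hPT : poitouTate_selmerStructure_duality ℚ)
    (hL : RankZero.Leaf W p) (htors : ¬ p ∣ W.torsionOrder)
    (hGrK : imKummer_ge_strictCondition_goodOrdinary)
    (hμ : MuPartAt W p) {n : ℕ} {S' : Set (ℕ × ℕ)} (hlam : AnalyticLambdaEq W p n)
    (S : Finset (HeightOneSpectrum (𝓞 ℚ))) (hSp : ∀ v ∈ S, ((p : ℕ) : 𝓞 ℚ) ∉ v.asIdeal)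
    (hcv : ∀ v ∈ S,
      p ∣ (W.baseChange (v.adicCompletion ℚ)).localTamagawaNumber (v.adicCompletionIntegers ℚ))
    (vp : HeightOneSpectrum (𝓞 ℚ)) (hvp : ((p : ℕ) : 𝓞 ℚ) ∈ vp.asIdeal)
    (hPt : ∃ P : (W.baseChange (vp.adicCompletion ℚ)).toAffine.Point, P ≠ 0 ∧ p • P = 0)
    (hS : AnalyticLamConstValDivisorSet W p S')
    (hgap : ∀ d v, (d, v) ∈ S' → S.card + 2 ≤ v → Even d → d ≤ n → n ≤ d + 1) : BSDp W p :=
  Leaf.bsdp_of_muPartAt_of_tamagawaCountAtP_two hW16 hGr h310 h415 hmod hGZK hPT hL htors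
    (Leaf.hloc_of_prop24 hGrK hL) hμ hlam S hSp hcv vp hvp hPt hS hgap

end Leaf

end Summit.BirchSwinnertonDyer.Rank1Residual.X1.GeneratorCountAnomalousLeaf

end
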